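import Literature.AlgebraicGeometry.HodgeTheory.SimpleAbelianSevenfoldPowersHodgeClasses
import Literature.AlgebraicGeometry.HodgeTheory.RibetTypeFourOddPowersHodgeClasses
import HarnessLib

/-!
# What remains of the Tankeev–Ribet theorem (Hodge classes on powers of simple abelian varieties of prime dimension) as a
# named fact of the tree: `End⁰ = ℚ` in prime dimension `p ≥ 11`, and imaginary-quadratic multiplicities `min(n′, n″) ≥ 5`
# except `{6, 7}` — census (Moonen–Zarhin 1999 Thm. (2.7); Ribet 1983 Thms. 0–3)

Family `hodge`, layer `Literature/AlgebraicGeometry/HodgeTheory`. Research context: cell `pub-hodge-ring2` (HONEST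
FRAMING: research route conditional on HC_CM; not a corollary; Q11.4-sentence-2 already refuted in dim ≥ 3),
Literature lane gen 83, programmes R61–R65, FINAL CENSUS. UNCONDITIONAL; theorems only, no definition, no named fact
(D-0026), no `sorry`. The tree's `tankeevRibet1983_iff_generic_and_unitary_ge_four_prime_ge_eleven`
(`SimpleAbelianSevenfoldPowersHodgeClasses`) says: the named fact `TankeevRibet1983_hodgeClasses_divisorial_powers_simplePrimeDimension`
is equivalent to its two residual shapes in prime dimension `p ≥ 11` — (S1) `End⁰ = ℚ` and (S2⁗) `End⁰ = k` imaginary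
quadratic with both multiplicities `≥ 4`. With the `(4, odd)` family theorem (`RibetTypeFourOddPowersHodgeClasses`) and the
`(6,7)` cell (`RibetTypeHigherCoprimePowersHodgeClasses`) the unitary residual shrinks to: both multiplicities `≥ 5` and
`{n′, n″} ≠ {6, 7}`.

## References
* [MoonenZarhin1999LowDim] B. Moonen, Yu. Zarhin, Math. Ann. 315 (1999), §2 (2.4)–(2.7).
* [Ribet1983] K. A. Ribet, Amer. J. Math. 105 (1983), Thms. 0–3.
* [Gordon1999HodgeAVSurvey] B. B. Gordon, *A survey of the Hodge conjecture for abelian varieties*, Thm. 6.3 and Corollary.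
-/

noncomputable section

open CategoryTheory Module

namespace Literature.AlgebraicGeometry.HodgeTheory

open Literature.AlgebraicGeometry.Motives

section Main

/-- **The Tankeev–Ribet fact is EQUIVALENT to: (S1) `B = D` on the powers of simple `X` of prime dimension `p ≥ 11` with
`End⁰(X) = ℚ`, and (S2⁵) the same for simple `X` of prime dimension with `End⁰ = k` imaginary quadratic acting with both
multiplicities `≥ 5` and `{n′, n″} ≠ {6, 7}`** — every other case is an unconditional theorem of the tree (primes
`2, 3, 5, 7` entirely; `min(n′, n″) ≤ 4`; `(6, 7)`). [cite: MoonenZarhin1999LowDim, §2 (2.4)–(2.7)]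
[cite: Gordon1999HodgeAVSurvey, Thm. 6.3 and Corollary] [cite: Ribet1983, Thms. 1 and 3] -/
theorem tankeevRibet1983_iff_generic_ge_eleven_and_unitary_ge_five :
    TankeevRibet1983_hodgeClasses_divisorial_powers_simplePrimeDimension ↔
      (∀ X : AbelianVariety ℂ, X.dim.Prime → 11 ≤ X.dim → X.IsSimple → Module.finrank ℚ X.endAlgebra = 1 →
        ∀ N : ℕ, IsDivisorGenerated (X.powSucc N)) ∧
      (∀ (X : AbelianVariety ℂ) (φ : X ⟶ X) (d : ℕ), X.dim.Prime → X.IsSimple → 0 < d →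
        φ ≫ φ = -(d • 𝟙 X) → Module.finrank ℚ X.endAlgebra = 2 →
        5 ≤ eigenMultiplicity X φ (Complex.I * (Real.sqrt d : ℂ)) →
        5 ≤ eigenMultiplicity X φ (-(Complex.I * (Real.sqrt d : ℂ))) →
        ¬ (eigenMultiplicity X φ (Complex.I * (Real.sqrt d : ℂ)) = 6 ∧
            eigenMultiplicity X φ (-(Complex.I * (Real.sqrt d : ℂ))) = 7) →
        ¬ (eigenMultiplicity X φ (Complex.I * (Real.sqrt d : ℂ)) = 7 ∧
            eigenMultiplicity X φ (-(Complex.I * (Real.sqrt d : ℂ))) = 6) →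
        ∀ N : ℕ, IsDivisorGenerated (X.powSucc N)) := by
  rw [tankeevRibet1983_iff_generic_and_unitary_ge_four_prime_ge_eleven]
  refine ⟨fun ⟨hS1, hS4⟩ => ⟨hS1, fun X φ d hp hs hd hφ he2 ha hb _ _ N => ?_⟩, fun ⟨hS1, hS5⟩ => ⟨hS1, ?_⟩⟩
  · -- both multiplicities `≥ 5` force `dim X ≥ 10`, hence `≥ 11` (`10` is not prime)
    have hsum := eigenMultiplicity_add_eigenMultiplicity_neg_eq_dim X φ hd hφ
    have h11 : 11 ≤ X.dim := by
      have h10 : 10 ≤ X.dim := by omega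
      rcases Nat.lt_or_ge X.dim 11 with hlt | hge
      · exfalso
        have h10' : X.dim = 10 := by omega
        exact absurd (h10' ▸ hp) (by decide)
      · exact hge
    exact hS4 X φ d hp h11 hs hd hφ he2 (by omega) (by omega) N
  · intro X φ d hp h11 hs hd hφ he2 ha hb N
    have hsum := eigenMultiplicity_add_eigenMultiplicity_neg_eq_dim X φ hd hφ
    have hodd : Odd X.dim := hp.odd_of_ne_two (by omega)
    by_cases h4 : eigenMultiplicity X φ (Complex.I * (Real.sqrt d : ℂ)) = 4 ∨
        eigenMultiplicity X φ (-(Complex.I * (Real.sqrt d : ℂ))) = 4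
    · exact AbelianVariety.isDivisorGenerated_powSucc_of_ribetTypeFourOdd X φ hd hφ he2 hodd h4 N
    by_cases h67 : (eigenMultiplicity X φ (Complex.I * (Real.sqrt d : ℂ)) = 6 ∧
          eigenMultiplicity X φ (-(Complex.I * (Real.sqrt d : ℂ))) = 7) ∨
        (eigenMultiplicity X φ (Complex.I * (Real.sqrt d : ℂ)) = 7 ∧
          eigenMultiplicity X φ (-(Complex.I * (Real.sqrt d : ℂ))) = 6)
    · have h13 : X.dim = 13 := by omega
      have h6 : eigenMultiplicity X φ (Complex.I * (Real.sqrt d : ℂ)) = 6 ∨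
          eigenMultiplicity X φ (-(Complex.I * (Real.sqrt d : ℂ))) = 6 := by omega
      exact AbelianVariety.isDivisorGenerated_powSucc_of_thirteenfold_sixSeven X φ hd hφ he2 h13 h6 N
    · simp only [not_or] at h4 h67
      exact hS5 X φ d hp hs hd hφ he2 (by omega) (by omega) h67.1 h67.2 N

end Main

end Literature.AlgebraicGeometry.HodgeTheory

end
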